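import Summits.ResolutionOfSingularities.ResolutionOfSingularities.Theorems.MarkedTransferCampaignW46ExitTreeBranching
import Summits.ResolutionOfSingularities.ResolutionOfSingularities.Theorems.MarkedTransferCampaignW46ExitTreeChain
import Mathlib.RingTheory.Filtration
import HarnessLib

/-!
# [OURS · L1 W4.6 rung (i-b)] The LOOSE exit tree of a marked ideal on a surface germ: loose steps (point blow-up
# followed by the forced blow-ups of the exceptional curve), the tree, Zariski's count, finite branching
# (cell res-hironaka, LADDER-RESOLUTION rung L, D-0089; campaign s46, prover res-L1-s46-pv-1; host route MarkedTransfer,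
# `--supports stmt-ResolutionOfSingularities-16155`)

HONEST FRAMING. Nothing here is a statement of H. Hironaka's manuscript (2017-03-23, [Hironaka2017]); pure commutative
algebra inside a field `K`, in the currency of res-L1-s46-pv-8's marked quadratic tree (`MarkedTransferCampaignW46ExitTree.lean`,
p500395: `MarkedNode`, `IsSingularNode`, `ctrlTransform`; `…ExitTreeBranching.lean`, p501084: the chart calculus). AI-written;
weaker than expert review. No `sorry`; axioms standard.

## What (rung (i-b) «procrastination is the only obstruction on surfaces», local invariant)

For rung (i-a) (isolated singular locus) the marked tree steps out of TAME nodes (`b ≤ ord J < 2b`) by the controlled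
transform `(J S' : x^b)`. When curves of the singular locus may be blown up as well, a point blow-up at a node of order
`r = ord J ≥ 2b` is followed by the forced blow-ups of the exceptional curve (it lies in the singular locus with
multiplicity `r - b ≥ b`) until its multiplicity drops below `b`: in the local ring `S'` of a point of the exceptional curve
the ideal becomes the LOOSE TRANSFORM `(J S' : x^m)` with `m = b·⌊r/b⌋` (`looseExponent`, `looseTransform`). The LOOSE
EXIT TREE above a node `⟨S, J⟩` collects the nodes reachable by loose steps out of ISOLATED nodes (singular, `J ⊄ (q^b)` for
every prime `q` — no curve of the singular locus through the point —, Japanese prime quotients) which are singular; its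
cardinality `looseExitCount` is the local termination measure of rung (i-b) (companion `…LooseExitTreeFinite.lean`: the tree
is finite by the loose thread-chain theorem `not_isLooseThreadChain`, p513724…).

## Contents

* `exactOrder S J` (the `𝔪`-adic order of `J ≠ 0`, Krull), `looseExponent b S J = b·⌊ord J / b⌋`, `looseTransform`.
* `IsIsolatedNode`, `LooseStep`, `looseExitTree`, `looseExitCount`; elementary lemmas (as for the marked tree).
* `span_pow_mul_looseTransform` — the product law `(x^m) · (J S' : x^m) = J S'`.
* `looseChild`, `sum_looseExitCount_add_one_le` / `sum_looseExitCount_lt` — Zariski's count (finite tree assumed).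
* (finite branching — `finite_setOf_looseStep_isSingularNode` — is the companion `…LooseExitTreeBranching.lean`.)

## References

* O. Zariski, P. Samuel, *Commutative Algebra* II (1960), Appendix 5. [ZariskiSamuel1960]
* C. Huneke, I. Swanson, *Integral Closure of Ideals, Rings, and Modules* (2006), §14.2–14.3. [HunekeSwanson2006]
* res-L1-s46-pv-8 (res-D-pv-044), `Theorems/MarkedTransferCampaignW46ExitTree*.lean` (the marked tree, rung (i-a)′).
-/

noncomputable section

open IsLocalRing

-- single-problem summit: the doubled namespace component `ResolutionOfSingularities` is forced
set_option linter.dupNamespace false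

namespace Summit.ResolutionOfSingularities.ResolutionOfSingularities.Theorems.CampaignW46

open Literature.AlgebraicGeometry.Resolution

universe u

variable {K : Type u} [Field K]

/-! ## The exact order and the loose exponent -/

section Order

variable {S : Subring K} [IsLocalRing S]

/-- **The exact `𝔪`-adic order** of an ideal `J` of the local ring `S`: the least `r` with `J ⊄ 𝔪^{r+1}` (junk value `0`
if `J ⊆ 𝔪^k` for all `k`, i.e. `J = 0` in the Noetherian case). [folklore] -/
def exactOrder (S : Subring K) [IsLocalRing S] (J : Ideal S) : ℕ := by
  classical
  exact if h : ∃ k, ¬ J ≤ maximalIdeal S ^ (k + 1) then Nat.find h else 0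

/-- Krull's intersection theorem: a non-zero ideal of a Noetherian local ring is not inside every power of `𝔪`.
[folklore] -/
theorem exists_not_le_pow [IsNoetherianRing S] {J : Ideal S} (hJ : J ≠ ⊥) :
    ∃ k, ¬ J ≤ maximalIdeal S ^ (k + 1) := by
  by_contra h
  push Not at h
  apply hJ
  have hle : J ≤ ⨅ i, maximalIdeal S ^ i := le_iInf fun i => by
    cases i with
    | zero => rw [pow_zero, Ideal.one_eq_top]; exact le_top
    | succ k => exact h k
  rw [Ideal.iInf_pow_eq_bot_of_isLocalRing _ (maximalIdeal.isMaximal S).ne_top] at hle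
  exact le_bot_iff.mp hle

/-- `J ⊆ 𝔪^{ord J}`. [folklore] -/
theorem le_pow_exactOrder (J : Ideal S) : J ≤ maximalIdeal S ^ exactOrder S J := by
  classical
  unfold exactOrder
  split_ifs with h
  · rcases Nat.eq_zero_or_pos (Nat.find h) with h0 | hpos
    · rw [h0, pow_zero, Ideal.one_eq_top]; exact le_top
    · have := Nat.find_min h (show Nat.find h - 1 < Nat.find h by omega)
      push Not at this
      rwa [show Nat.find h - 1 + 1 = Nat.find h by omega] at this
  · rw [pow_zero, Ideal.one_eq_top]; exact le_top

/-- `J ⊄ 𝔪^{ord J + 1}` (for `J ≠ 0` in a Noetherian local ring). [folklore] -/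
theorem not_le_pow_exactOrder_succ [IsNoetherianRing S] {J : Ideal S} (hJ : J ≠ ⊥) :
    ¬ J ≤ maximalIdeal S ^ (exactOrder S J + 1) := by
  classical
  have h := exists_not_le_pow hJ
  unfold exactOrder
  rw [dif_pos h]
  exact Nat.find_spec h

/-- `b ≤ ord J` when `J ⊆ 𝔪^b`, `J ≠ 0`. [folklore] -/
theorem le_exactOrder_of_le_pow [IsNoetherianRing S] {J : Ideal S} (hJ : J ≠ ⊥) {b : ℕ}
    (hb : J ≤ maximalIdeal S ^ b) : b ≤ exactOrder S J := by
  by_contra hlt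
  push Not at hlt
  exact not_le_pow_exactOrder_succ hJ (hb.trans (Ideal.pow_le_pow_right (by omega)))

/-- **The loose exponent** `m = b·⌊ord J / b⌋`: the total power of the exceptional parameter divided out by the point
blow-up (`b`) and the forced blow-ups of the exceptional curve (`b` each, while its multiplicity is `≥ b`). [folklore] -/
def looseExponent (b : ℕ) (S : Subring K) [IsLocalRing S] (J : Ideal S) : ℕ :=
  b * (exactOrder S J / b)

/-- `m ≤ ord J`. [folklore] -/
theorem looseExponent_le (b : ℕ) (J : Ideal S) : looseExponent b S J ≤ exactOrder S J :=
  Nat.mul_div_le _ _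

/-- `ord J < m + b`. [folklore] -/
theorem exactOrder_lt_looseExponent_add {b : ℕ} (hb : 0 < b) (J : Ideal S) :
    exactOrder S J < looseExponent b S J + b := by
  unfold looseExponent
  have h1 := Nat.div_add_mod (exactOrder S J) b
  have h2 := Nat.mod_lt (exactOrder S J) hb
  omega

/-- `b ∣ m`. [folklore] -/
theorem dvd_looseExponent (b : ℕ) (J : Ideal S) : b ∣ looseExponent b S J :=
  dvd_mul_right _ _

/-- `b ≤ m` when `b ≤ ord J`. [folklore] -/
theorem le_looseExponent {b : ℕ} (hb : 0 < b) {J : Ideal S} (hbr : b ≤ exactOrder S J) :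
    b ≤ looseExponent b S J := by
  unfold looseExponent
  have h1 : 1 ≤ exactOrder S J / b := (Nat.le_div_iff_mul_le hb).mpr (by rwa [one_mul])
  calc b = b * 1 := (mul_one b).symm
    _ ≤ b * (exactOrder S J / b) := Nat.mul_le_mul_left _ h1

end Order

/-! ## The loose transform, isolated nodes, loose steps, the loose exit tree -/

/-- **The loose transform** of the ideal `J` of the local ring `S ⊆ K` at an over-ring `S'` (meant: a first quadratic
transform): `(J S' : (𝔪_S S')^m)`, `m = b·⌊ord J/b⌋` — the controlled transform with the loose exponent. For a first
quadratic transform with chart element `x` this is `x^{-m} · J S'`: the stalk, at a point of the last exceptional curve, of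
`(J, b)` after the point blow-up and the forced blow-ups of that curve. [folklore] -/
def looseTransform (b : ℕ) (S : Subring K) [IsLocalRing S] (J : Ideal S) (S' : Subring K) : Ideal S' :=
  ctrlTransform (looseExponent b S J) S J S'

/-- **An isolated node** for the exponent `b`: a singular node `⟨S, J⟩` (`S` a two-dimensional regular local ring of
`K`, `J ⊆ 𝔪^b`) of ISOLATED TYPE — no prime element `q` has `J ⊆ (q^b)` (no curve of the singular locus of `(J, b)`
passes through the closed point) — whose prime quotients have module-finite normalization (the stalks of schemes of
finite type over a field are of this kind). The nodes out of which the loose tree steps. [folklore] -/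
def IsIsolatedNode (b : ℕ) (n : MarkedNode K) : Prop :=
  IsSingularNode b n ∧ (∀ q : n.1, Prime q → ¬ n.2 ≤ Ideal.span {q ^ b}) ∧
    ∀ P : Ideal n.1, P.IsPrime → Module.Finite (n.1 ⧸ P) (integralClosure (n.1 ⧸ P) (FractionRing (n.1 ⧸ P)))

/-- **One loose step**: out of an ISOLATED node `⟨S, J⟩`, to a two-dimensional first quadratic transform `S'` of `S`
marked with the loose transform of `J`. [folklore] -/
def LooseStep (b : ℕ) (n n' : MarkedNode K) : Prop :=
  IsIsolatedNode b n ∧ ∃ (_ : IsLocalRing n.1), IsQuadraticTransform n.1 n'.1 ∧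
    ringKrullDim n'.1 = 2 ∧ n'.2 = looseTransform b n.1 n.2 n'.1

/-- **The loose exit tree** above the node `n₀`: the nodes reachable from `n₀` by loose steps (through isolated nodes
only) which are themselves singular. [cite: ZariskiSamuel1960, Appendix 5] -/
def looseExitTree (b : ℕ) (n₀ : MarkedNode K) : Set (MarkedNode K) :=
  {n | Relation.ReflTransGen (LooseStep b) n₀ n ∧ IsSingularNode b n}

/-- **The loose exit count** `ν̃(S, J, b)`: the number of nodes of the loose exit tree above `⟨S, J⟩` (`0` if the tree
is infinite). [cite: ZariskiSamuel1960, Appendix 5] -/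
def looseExitCount (b : ℕ) (S : Subring K) (J : Ideal S) : ℕ :=
  (looseExitTree b (⟨S, J⟩ : MarkedNode K)).ncard

/-! ## Elementary properties -/

/-- An isolated node is singular. [folklore] -/
theorem IsIsolatedNode.isSingularNode {b : ℕ} {n : MarkedNode K} (h : IsIsolatedNode b n) :
    IsSingularNode b n := h.1

/-- At an isolated node `b > 0` (for `b = 0`, `(q^0) = S ⊇ J`). [folklore] -/
theorem IsIsolatedNode.b_pos {b : ℕ} {n : MarkedNode K} (h : IsIsolatedNode b n) : 0 < b := by
  obtain ⟨⟨hreg, hdim, -, -⟩, hiso, -⟩ := h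
  haveI := hreg
  by_contra h0
  rw [not_lt, Nat.le_zero] at h0
  obtain ⟨u, v, -, hup, -⟩ := exists_maximalIdeal_eq_span_pair hdim
  apply hiso u hup
  rw [h0, pow_zero, Ideal.span_singleton_one]
  exact le_top

/-- At an isolated node `J ≠ 0` (`0 ⊆ (q^b)` for the prime `q` of any regular parameter). [folklore] -/
theorem IsIsolatedNode.ne_bot {b : ℕ} {n : MarkedNode K} (h : IsIsolatedNode b n) : n.2 ≠ ⊥ := by
  obtain ⟨⟨hreg, hdim, -, -⟩, hiso, -⟩ := h
  haveI := hreg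
  obtain ⟨u, v, -, hup, -⟩ := exists_maximalIdeal_eq_span_pair hdim
  intro h0
  apply hiso u hup
  rw [h0]
  exact bot_le

/-- At an isolated node `b ≤ ord J`, hence `b ≤ m ≤ ord J < m + b` for the loose exponent `m`. [folklore] -/
theorem IsIsolatedNode.le_exactOrder {b : ℕ} {S : Subring K} {J : Ideal S} [IsLocalRing S]
    (h : IsIsolatedNode b (⟨S, J⟩ : MarkedNode K)) : b ≤ exactOrder S J := by
  obtain ⟨⟨hreg, -, -, hle⟩, -, -⟩ := id h
  haveI := hreg
  exact le_exactOrder_of_le_pow h.ne_bot hle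

/-- The source of a loose step is an isolated node. [folklore] -/
theorem LooseStep.isIsolatedNode {b : ℕ} {n n' : MarkedNode K} (h : LooseStep b n n') :
    IsIsolatedNode b n := h.1

/-- A loose step is a quadratic transform of the underlying rings. [folklore] -/
theorem LooseStep.isQuadraticTransform {b : ℕ} {n n' : MarkedNode K} (h : LooseStep b n n') :
    IsQuadraticTransform n.1 n'.1 := by
  obtain ⟨-, _, hq, -, -⟩ := h
  exact hq

/-- The target of a loose step is two-dimensional. [folklore] -/
theorem LooseStep.ringKrullDim_eq {b : ℕ} {n n' : MarkedNode K} (h : LooseStep b n n') :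
    ringKrullDim n'.1 = 2 := by
  obtain ⟨-, _, -, hd, -⟩ := h
  exact hd

/-- The marked ideal of the target of a loose step is the loose transform. [folklore] -/
theorem LooseStep.snd_eq {b : ℕ} {n n' : MarkedNode K} (h : LooseStep b n n')
    (hS : IsLocalRing n.1) : n'.2 = @looseTransform K _ b n.1 hS n.2 n'.1 := by
  obtain ⟨-, _, -, -, he⟩ := h
  exact he

/-- Reachability in the loose tree projects to the tree of iterated quadratic transforms. [folklore] -/
theorem reflTransGen_isQuadraticTransform_of_looseStep {b : ℕ} {n n' : MarkedNode K}
    (h : Relation.ReflTransGen (LooseStep b) n n') :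
    Relation.ReflTransGen IsQuadraticTransform n.1 n'.1 := by
  induction h with
  | refl => exact Relation.ReflTransGen.refl
  | tail _ hs ih => exact ih.tail hs.isQuadraticTransform

/-- The root lies in its own loose tree iff it is singular. [folklore] -/
theorem self_mem_looseExitTree_iff {b : ℕ} {n₀ : MarkedNode K} :
    n₀ ∈ looseExitTree b n₀ ↔ IsSingularNode b n₀ :=
  ⟨fun h => h.2, fun h => ⟨Relation.ReflTransGen.refl, h⟩⟩

/-- The loose tree above the target of a loose step lies in the loose tree above its source. [folklore] -/
theorem looseExitTree_subset_of_looseStep {b : ℕ} {n₀ n₁ : MarkedNode K} (h : LooseStep b n₀ n₁) :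
    looseExitTree b n₁ ⊆ looseExitTree b n₀ := fun _ hn =>
  ⟨Relation.ReflTransGen.head h hn.1, hn.2⟩

/-- **Decomposition through the first steps** of the loose tree. [folklore] -/
theorem mem_looseExitTree_cases {b : ℕ} {n₀ n : MarkedNode K} (hn : n ∈ looseExitTree b n₀) :
    n = n₀ ∨ ∃ n₁, LooseStep b n₀ n₁ ∧ n ∈ looseExitTree b n₁ := by
  rcases Relation.ReflTransGen.cases_head hn.1 with rfl | ⟨n₁, h₁, h₂⟩
  · exact Or.inl rfl
  · exact Or.inr ⟨n₁, h₁, h₂, hn.2⟩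

/-- Out of a node that is not isolated there is no loose step: its tree is `{n₀}` or empty. [folklore] -/
theorem looseExitTree_subset_singleton_of_not_isIsolatedNode {b : ℕ} {n₀ : MarkedNode K}
    (h : ¬ IsIsolatedNode b n₀) : looseExitTree b n₀ ⊆ {n₀} := by
  intro n hn
  rcases mem_looseExitTree_cases hn with rfl | ⟨n₁, h₁, -⟩
  · rfl
  · exact absurd h₁.isIsolatedNode h

/-- A positive loose exit count at a singular node with finite loose tree. [folklore] -/
theorem one_le_looseExitCount {b : ℕ} {S : Subring K} {J : Ideal S}
    (h : IsSingularNode b (⟨S, J⟩ : MarkedNode K))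
    (hfin : (looseExitTree b (⟨S, J⟩ : MarkedNode K)).Finite) : 1 ≤ looseExitCount b S J := by
  rw [looseExitCount, Nat.one_le_iff_ne_zero, Ne, Set.ncard_eq_zero hfin]
  exact fun he => by simpa [he] using self_mem_looseExitTree_iff.mpr h

/-! ## The product law of the loose transform -/

section Law

variable {b : ℕ} {S : Subring K} [IsRegularLocalRing S] {J : Ideal S}

/-- **`(x^m) · (J S' : x^m) = J S'`** for a generator `x` of `𝔪_S S'` (`S ≤ S'`): `m = b·⌊ord J/b⌋ ≤ ord J`, so
`J S' ⊆ 𝔪^m S' = (x^m)`. [folklore] -/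
theorem span_pow_mul_looseTransform (b : ℕ) {S' : Subring K}
    (hSS' : S ≤ S') (x : S') (hmx : extIdeal (maximalIdeal S) S' = Ideal.span {x}) :
    Ideal.span {x ^ looseExponent b S J} * looseTransform b S J S' = extIdeal J S' := by
  have hle : extIdeal J S' ≤ Ideal.span {x ^ looseExponent b S J} := by
    rw [← Ideal.span_singleton_pow, ← hmx, extIdeal_eq_map _ hSS', extIdeal_eq_map _ hSS', ← Ideal.map_pow]
    exact Ideal.map_mono ((le_pow_exactOrder J).trans (Ideal.pow_le_pow_right (looseExponent_le b J)))
  have h := eq_span_singleton_mul_colon_span hle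
  rw [looseTransform, ctrlTransform, hmx, Ideal.span_singleton_pow]
  exact h.symm

end Law

/-! ## Zariski's count on the loose tree -/

section Count

variable {b : ℕ} {S : Subring K} [IsRegularLocalRing S] {J : Ideal S}

/-- The loose node of a first quadratic transform. [folklore] -/
def looseChild (b : ℕ) (S : Subring K) [IsLocalRing S] (J : Ideal S) (S' : Subring K) : MarkedNode K :=
  ⟨S', looseTransform b S J S'⟩

omit [IsRegularLocalRing S] in
/-- An isolated node steps loosely to each of its two-dimensional first quadratic transforms. [folklore] -/
theorem looseStep_looseChild [IsLocalRing S] (hS : IsIsolatedNode b (⟨S, J⟩ : MarkedNode K))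
    {S' : Subring K} (h' : IsQuadraticTransform S S') (hd' : ringKrullDim S' = 2) :
    LooseStep b (⟨S, J⟩ : MarkedNode K) (looseChild b S J S') :=
  ⟨hS, ‹_›, h', hd', rfl⟩

/-- The root is not in the loose tree above a first quadratic transform. [folklore] -/
theorem root_not_mem_looseExitTree_looseChild (hdim : ringKrullDim S = 2) {S' : Subring K}
    (h' : IsQuadraticTransform S S') {n : MarkedNode K}
    (hn : n ∈ looseExitTree b (looseChild b S J S')) : n ≠ (⟨S, J⟩ : MarkedNode K) := by
  intro he
  have hq := reflTransGen_isQuadraticTransform_of_looseStep hn.1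
  rw [he] at hq
  exact not_reflTransGen_of_isQuadraticTransform h'
    (fun _ z => maximalIdeal_ne_span_singleton hdim z) hq

/-- The loose trees above distinct first quadratic transforms are disjoint. [folklore] -/
theorem disjoint_looseExitTree_looseChild {S₁ S₂ : Subring K} (h₁ : IsQuadraticTransform S S₁)
    (h₂ : IsQuadraticTransform S S₂) (hne : S₁ ≠ S₂) :
    Disjoint (looseExitTree b (looseChild b S J S₁)) (looseExitTree b (looseChild b S J S₂)) := by
  refine Set.disjoint_left.mpr fun n hn₁ hn₂ => hne ?_
  exact h₁.eq_of_reflTransGen h₂ (IsNoetherian.noetherian _)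
    (reflTransGen_isQuadraticTransform_of_looseStep hn₁.1)
    (reflTransGen_isQuadraticTransform_of_looseStep hn₂.1)

/-- **Zariski's count on the loose tree**: if `⟨S, J⟩` is an isolated node with finite loose tree, then for every
finite set `F` of distinct two-dimensional first quadratic transforms `S'` of `S`,
`∑_{S' ∈ F} ν̃(S', J̃', b) + 1 ≤ ν̃(S, J, b)` where `J̃'` is the loose transform. [cite: ZariskiSamuel1960, Appendix 5] -/
theorem sum_looseExitCount_add_one_le (hS : IsIsolatedNode b (⟨S, J⟩ : MarkedNode K))
    (hfin : (looseExitTree b (⟨S, J⟩ : MarkedNode K)).Finite) (F : Finset (Subring K))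
    (hF : ∀ S' ∈ F, IsQuadraticTransform S S' ∧ ringKrullDim S' = 2) :
    ∑ S' ∈ F, looseExitCount b S' (looseTransform b S J S') + 1 ≤ looseExitCount b S J := by
  classical
  obtain ⟨⟨_, hdim, -, -⟩, -, -⟩ := id hS
  -- the subtrees of the members of `F`: subsets of `looseExitTree ∖ {root}`
  have hsub : ∀ S' ∈ F, looseExitTree b (looseChild b S J S') ⊆
      looseExitTree b (⟨S, J⟩ : MarkedNode K) \ {(⟨S, J⟩ : MarkedNode K)} := fun S' hS' n hn =>
    ⟨looseExitTree_subset_of_looseStep (looseStep_looseChild hS (hF S' hS').1 (hF S' hS').2) hn,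
      fun he => root_not_mem_looseExitTree_looseChild hdim (hF S' hS').1 hn
        (Set.mem_singleton_iff.mp he)⟩
  have hdisj : ∀ S₁ ∈ F, ∀ S₂ ∈ F, S₁ ≠ S₂ →
      Disjoint (looseExitTree b (looseChild b S J S₁)) (looseExitTree b (looseChild b S J S₂)) :=
    fun S₁ hS₁ S₂ hS₂ hne => disjoint_looseExitTree_looseChild (hF S₁ hS₁).1 (hF S₂ hS₂).1 hne
  -- counting with finsets inside the finite set `T = looseExitTree b ⟨S, J⟩`
  set T : Finset (MarkedNode K) := hfin.toFinset with hT
  have hTcard : looseExitCount b S J = T.card := Set.ncard_eq_toFinset_card _ hfin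
  let t : Subring K → Finset (MarkedNode K) := fun S' =>
    T.filter (· ∈ looseExitTree b (looseChild b S J S'))
  have ht : ∀ S' ∈ F, ((t S' : Finset (MarkedNode K)) : Set (MarkedNode K)) =
      looseExitTree b (looseChild b S J S') := by
    intro S' hS'
    ext n
    simp only [t, Finset.coe_filter, Set.Finite.mem_toFinset, Set.mem_setOf_eq, hT]
    exact ⟨fun hn => hn.2, fun hn => ⟨(hsub S' hS' hn).1, hn⟩⟩
  have htcard : ∀ S' ∈ F, looseExitCount b S' (looseTransform b S J S') = (t S').card :=
    fun S' hS' => by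
    rw [looseExitCount, show (⟨S', looseTransform b S J S'⟩ : MarkedNode K) = looseChild b S J S' from rfl,
      ← ht S' hS', Set.ncard_coe_finset]
  have hdisj' : (F : Set (Subring K)).PairwiseDisjoint t := by
    intro S₁ hS₁ S₂ hS₂ hne
    rw [Function.onFun, Finset.disjoint_coe.symm, ht S₁ hS₁, ht S₂ hS₂]
    exact hdisj S₁ hS₁ S₂ hS₂ hne
  have hsum : ∑ S' ∈ F, looseExitCount b S' (looseTransform b S J S') = (F.biUnion t).card := by
    rw [Finset.card_biUnion hdisj']
    exact Finset.sum_congr rfl htcard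
  have hRT : (⟨S, J⟩ : MarkedNode K) ∈ T := by
    rw [hT, Set.Finite.mem_toFinset]
    exact self_mem_looseExitTree_iff.mpr hS.isSingularNode
  have hle : F.biUnion t ⊆ T.erase (⟨S, J⟩ : MarkedNode K) := by
    intro n hn
    obtain ⟨S', hS', hn⟩ := Finset.mem_biUnion.mp hn
    have hn' : n ∈ looseExitTree b (looseChild b S J S') := by rw [← ht S' hS']; exact hn
    obtain ⟨h1, h2⟩ := hsub S' hS' hn'
    exact Finset.mem_erase.mpr ⟨fun e => h2 (Set.mem_singleton_iff.mpr e),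
      by rw [hT, Set.Finite.mem_toFinset]; exact h1⟩
  have hcard := Finset.card_le_card hle
  rw [Finset.card_erase_of_mem hRT] at hcard
  rw [hsum, hTcard]
  have hpos : 0 < T.card := Finset.card_pos.mpr ⟨_, hRT⟩
  omega

/-- The strict form of Zariski's count on the loose tree. [cite: ZariskiSamuel1960, Appendix 5] -/
theorem sum_looseExitCount_lt (hS : IsIsolatedNode b (⟨S, J⟩ : MarkedNode K))
    (hfin : (looseExitTree b (⟨S, J⟩ : MarkedNode K)).Finite) (F : Finset (Subring K))
    (hF : ∀ S' ∈ F, IsQuadraticTransform S S' ∧ ringKrullDim S' = 2) :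
    ∑ S' ∈ F, looseExitCount b S' (looseTransform b S J S') < looseExitCount b S J :=
  sum_looseExitCount_add_one_le hS hfin F hF

end Count

end Summit.ResolutionOfSingularities.ResolutionOfSingularities.Theorems.CampaignW46

end
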